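import Summits.QuantumFields.BalabanUV.Beta.EriceFlowEnclosureB12AsPrintedHistoryContagionShiftFlowZeroIsometry

/-!
# Beta / EriceFlowEnclosureB12AsPrintedHistoryContagionShiftFlowZeroIsometryTwoLoop — ASYMPTOTIC FREEDOM IS CONTAGIOUS, part 49: TWO-LOOP ASYMPTOTIC SCALING OF THE Λ₂-COORDINATE.
# Part 40 gave, under the two-loop letter with memory, the absolute two-loop coordinate Λ₂ — a dynamical Abel function with comparison sequence `a(n) = nβ₀ + (b₁∕β₀)·log n`
# (`1∕h(n)² − nβ₀ − (b₁∕β₀) log n → Λ₂(e)` along every box solution from every pin).  Part 44: every dynamical Abel function is asymptotically chart-isometric at the zero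
# pin, and at ONE loop `Λ g = 1∕g² + O(1∕g)` (sharp).  HERE (§76): for ANY dynamical Abel function with THIS comparison sequence,
# **`Λ₂ g − 1∕g² + (b₁∕β₀)·log(1∕(β₀g²)) → 0` as `g → 0⁺`** (`tendsto_twoLoopScaling`) — the universal TWO-LOOP ASYMPTOTIC-SCALING EXPANSION
# **`Λ₂(g) = 1∕g² − (b₁∕β₀)·log(1∕(β₀g²)) + o(1)`** of the RG-invariant two-loop Λ-parameter in terms of the coupling, with NO free constant: along the reference trajectory it
# is part 40's convergence plus the clock `m·β₀·h′(m)² → 1` inside the logarithm (`tendsto_twoLoopScaling_seq`); in between two consecutive reference points the isometry of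
# part 44 carries it over with an error `≤ κ·h′(m)·W + (|b₁|∕β₀)·W·h′(m)²` (`abs_twoLoopScaling_sub_le`), W one chart increment.  By part 45 (canonicity criterion) Λ₂ is thus
# THE Abel function with this expansion: any Abel function of the trajectories with `Φ g − 1∕g² + (b₁∕β₀) log(1∕(β₀g²)) → C` is `Λ₂ + C` — the flow-with-memory form of
# the statement that the two-loop Λ-parameter is defined by the asymptotics `1∕g²(μ) = β₀ log(μ∕Λ)² + (b₁∕β₀) log log(μ∕Λ)² + o(1)`, read backwards.
# Abstract in B (β-flow team, prover 1, unit `b2b-balaban-beta-bflow-p1`, gen 40; ROW AP-I·Uc × NODE U2 × ROW Λ — two-loop asymptotic scaling)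

HONEST FRAMING (page 1 of everything the β sub-cell writes): discharging `BetaPertH` makes Bałaban's UV stability UNCONDITIONAL — a
real constructive-QFT result; it is NOT the continuum limit and NOT the Clay problem.  HONEST DEPENDENCY (cell reorg 2026-08-19,
verbatim): «continuum YM on T⁴ ⇐ BetaPertH ∧ nine spine estimates (0/9 proved); BetaPertH ⇐ (D1) ∧ (D4) ∧ CAP+tail; G-an2-4 gates
asym, D1 and NE2/3/4.»  THIS MODULE DISCHARGES NOTHING: elementary real analysis (logarithms: `log(xy) = log x + log y`, `0 ≤ log y ≤ y − 1` for `y ≥ 1`, continuity of log at 1;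
an ε∕δ assembly over the brackets of the reference trajectory) over node U2's HYPOTHESIS SHAPES on an ABSTRACT functional `B`; part 44's `abs_dynAbel_sub_sub_chart_le ∕
dynAbel_shift ∕ exists_bracket ∕ invSq_succ_sub_le`, part 33's `tendsto_mul_sq`, part 34's `succ_le_of_reference_flow ∕ le_envelope_of_reference_flow`, part 10's
`invSq_lower_of_reference_flow`, part 25's `exists_tail_scale_le` BY NAME — nothing restated; the EXISTENCE of Λ₂ under the two-loop letter (T2m) is part 40
(`twoLoopLambdaFunction_exists`), not re-proved: here Λ₂ is ANY dynamical Abel function with the two-loop comparison sequence.  PRECEDENT (by name): gen 15's #39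
`EriceFlowEnclosureAsymptoticScaling` (Markov ∕ Erice picture, under a Taylor clause (T) in g²: `Λ t − 1∕t − (β₂∕β₀)·log t → C_Λ`).  `ScaleShiftRate` (GAPS G-t4-U2-1),
`HistLipschitz`∕`FadingMemory` (G-t4-U2-2), [I] THEOREM 2 (p. 259, STATED WITHOUT PROOF) do not occur; NOTHING is asserted about Bałaban's actual β — whether ITS limit functional
obeys a two-loop letter with the printed `b₁` is Erice's (3.73)∕(3.76) read for the limit, NOT PRINTED ([I] p. 298).  [I] = T. Bałaban, Commun. Math. Phys. **109** (1987) 249–301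
[Balaban1987RG1].

WHAT THIS FILE PROVES (0 sorry, 0 def): §76 `log_invSq_eq`, **`tendsto_twoLoopScaling_seq`**, `abs_log_chart_ratio_le`, **`abs_twoLoopScaling_sub_le`**, **`tendsto_twoLoopScaling`**.
NOT CLAIMED: existence of Λ₂ without (T2m) (part 40's hypothesis); a rate in the o(1); anything about Bałaban's β; `BetaPertH`; continuum; Clay.
-/

namespace Summit.QuantumFields.BalabanUV.Beta.EriceFlowEnclosureB12AsPrintedHistoryContagionShiftFlowZeroIsometryTwoLoop

open Finset Filter Topology Set
open Literature.MathematicalPhysics.QuantumFieldTheory.Balaban1983to89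
open Literature.MathematicalPhysics.QuantumFieldTheory.Balaban1983to89.T4CouplingMatching (sprof sprof_pos)
open Literature.MathematicalPhysics.QuantumFieldTheory.Balaban1983to89.T4BetaStationary (SeqBox MemoryProfile)
open Literature.MathematicalPhysics.QuantumFieldTheory.Balaban1983to89.T4BetaFlowWellPosed (MemFlow solution)
open Summit.QuantumFields.BalabanUV.Beta.EriceFlowEnclosureB12AsPrintedHistoryContagionShiftFlow (invSq_lower_of_reference_flow)
open Summit.QuantumFields.BalabanUV.Beta.EriceFlowEnclosureB12AsPrintedHistoryContagionShiftFlowRepinTail (one_div_sprof_pos exists_tail_scale_le)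
open Summit.QuantumFields.BalabanUV.Beta.EriceFlowEnclosureB12AsPrintedHistoryContagionShiftFlowZeroClock (tendsto_mul_sq)
open Summit.QuantumFields.BalabanUV.Beta.EriceFlowEnclosureB12AsPrintedHistoryContagionShiftFlowZeroOffset (le_envelope_of_reference_flow succ_le_of_reference_flow)
open Summit.QuantumFields.BalabanUV.Beta.EriceFlowEnclosureB12AsPrintedHistoryContagionShiftFlowZeroIsometry (dynAbel_shift abs_dynAbel_sub_sub_chart_le
  exists_bracket invSq_succ_sub_le)

noncomputable section

/-! ## §76 Two-loop asymptotic scaling: along the reference trajectory, across the brackets, and as `g → 0⁺` -/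

/-- Splitting the logarithm along the trajectory: `log(1∕(β₀x²)) = log m + log(1∕(β₀·m·x²))` for `m ≥ 1`, β₀, x > 0. [folklore] -/
theorem log_invSq_eq {β₀ x : ℝ} {m : ℕ} (hβ₀ : 0 < β₀) (hx : 0 < x) (hm : 1 ≤ m) :
    Real.log (1 / (β₀ * x ^ 2)) = Real.log (m : ℝ) + Real.log (1 / (β₀ * ((m : ℝ) * x ^ 2))) := by
  have hm0 : (0 : ℝ) < m := by exact_mod_cast hm
  rw [← Real.log_mul hm0.ne' (by positivity)]
  congr 1
  field_simp

/-- **TWO-LOOP SCALING ALONG THE REFERENCE TRAJECTORY.**  `B` with memory profile on ]0, γ]^ℕ and the value β₀ at zero; ONE AF reference; part 10's package at the pin e′;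
h′ a box solution from e′; Λ₂ a dynamical Abel function with the TWO-LOOP comparison sequence `a(n) = nβ₀ + (b₁∕β₀) log n`.  THEN
**`Λ₂(h′ m) − 1∕h′(m)² + (b₁∕β₀)·log(1∕(β₀ h′(m)²)) → 0`**: by the Abel equation `Λ₂(h′ m) = Λ₂ e′ + mβ₀`, the expression is `(Λ₂ e′ − E_m) + (b₁∕β₀)·log(1∕(β₀·m·h′(m)²))`
with `E_m → Λ₂ e′` (definition) and `m·β₀·h′(m)² → 1` (part 33's clock). [folklore] -/
theorem tendsto_twoLoopScaling_seq {B : (ℕ → ℝ) → ℝ} {Cm θ γ β₀ b₁ bs ta gs e' : ℝ} {t h' : ℕ → ℝ} {Λ₂ : ℝ → ℝ}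
    (hB : MemoryProfile Cm θ γ B) (hCm : 0 ≤ Cm) (hθ0 : 0 ≤ θ) (hθ1 : θ < 1) (hbs : 0 < bs) (hta : 0 < ta)
    (h0 : ∀ u : ℕ → ℝ, SeqBox γ u → |B u - β₀| ≤ Cm * ∑' j, θ ^ j * u j)
    (hts : SeqBox γ t) (htf : MemFlow B gs t) (hprof : ∀ m : ℕ, 1 / ta ^ 2 + bs * (m : ℝ) ≤ 1 / (t m) ^ 2)
    (hΛ₂ : ∀ e ∈ Ioc (0 : ℝ) e', ∀ h : ℕ → ℝ, SeqBox γ h → MemFlow B e h →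
      Tendsto (fun n => 1 / h n ^ 2 - ((n : ℝ) * β₀ + b₁ / β₀ * Real.log (n : ℝ))) atTop (𝓝 (Λ₂ e)))
    (he' : 0 < e')
    (hs1 : 4 * Cm * e' ≤ bs * (1 - θ))
    (hs2 : e' ^ 2 * (1 / gs ^ 2 + Cm * γ / (1 - θ) ^ 2 + (2 * Cm / ((1 - θ) * bs)) ^ 2) ≤ 3 / 4)
    (hhs' : SeqBox γ h') (hhf' : MemFlow B e' h') :
    Tendsto (fun m : ℕ => Λ₂ (h' m) - 1 / h' m ^ 2 + b₁ / β₀ * Real.log (1 / (β₀ * h' m ^ 2))) atTop (𝓝 0) := by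
  have hβ₀ : 0 < β₀ :=
    EriceFlowEnclosureB12AsPrintedHistoryContagionShiftFlowZero.valueAtZero_pos hCm hθ0 hθ1 hbs hta h0 hts htf hprof
  have he'mem : e' ∈ Ioc (0 : ℝ) e' := ⟨he', le_rfl⟩
  have habel := dynAbel_shift hB hCm hθ0 hθ1 hbs hta h0 hts htf hprof hΛ₂ he'mem hhs' hhf' hs1 hs2
  have hE := hΛ₂ e' he'mem h' hhs' hhf'
  -- the clock inside the logarithm
  have hprof' : ∀ m : ℕ, 1 / (2 * e') ^ 2 + bs / 4 * (m : ℝ) ≤ 1 / (h' m) ^ 2 := fun m => by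
    have := invSq_lower_of_reference_flow hB hCm hθ0 hθ1 hbs hta hts htf hprof hhs' hhf' hs1 hs2 m
    rwa [show (1 : ℝ) / (2 * e') ^ 2 = 1 / (4 * e' ^ 2) by ring]
  have hclock := tendsto_mul_sq hCm hθ0 hθ1 (by positivity : 0 < bs / 4) (by positivity : (0 : ℝ) < 2 * e') h0 hhs' hhf' hprof'
  have hq : Tendsto (fun m : ℕ => 1 / (β₀ * ((m : ℝ) * h' m ^ 2))) atTop (𝓝 1) := by
    have h1 : Tendsto (fun m : ℕ => β₀ * ((m : ℝ) * h' m ^ 2)) atTop (𝓝 (β₀ * (1 / β₀))) := hclock.const_mul β₀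
    rw [mul_one_div_cancel hβ₀.ne'] at h1
    have := h1.inv₀ one_ne_zero
    simpa [one_div] using this
  have hlog : Tendsto (fun m : ℕ => Real.log (1 / (β₀ * ((m : ℝ) * h' m ^ 2)))) atTop (𝓝 0) := by
    have h := hq.log one_ne_zero
    rwa [Real.log_one] at h
  -- assemble: for m ≥ 1 the expression is `(Λ₂ e′ − E_m) + (b₁∕β₀)·log q_m`
  have hlim : Tendsto (fun m : ℕ => (Λ₂ e' - (1 / h' m ^ 2 - ((m : ℝ) * β₀ + b₁ / β₀ * Real.log (m : ℝ))))
      + b₁ / β₀ * Real.log (1 / (β₀ * ((m : ℝ) * h' m ^ 2)))) atTop (𝓝 ((Λ₂ e' - Λ₂ e') + b₁ / β₀ * 0)) :=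
    (tendsto_const_nhds.sub hE).add (hlog.const_mul _)
  rw [sub_self, mul_zero, add_zero] at hlim
  refine hlim.congr' ?_
  filter_upwards [eventually_ge_atTop 1] with m hm
  rw [habel m, log_invSq_eq hβ₀ (hhs' m).1 hm]
  ring

/-- The logarithmic term across a bracket: for `0 < g ≤ h` with `1∕g² − 1∕h² ≤ W` (β₀ > 0): `|log(1∕(β₀g²)) − log(1∕(β₀h²))| ≤ W·h²` (`0 ≤ log y ≤ y − 1` for
`y = h²∕g² ∈ [1, 1 + W h²]`). [folklore] -/
theorem abs_log_chart_ratio_le {β₀ W g h : ℝ} (hβ₀ : 0 < β₀) (hg : 0 < g) (hgh : g ≤ h) (hW : 1 / g ^ 2 - 1 / h ^ 2 ≤ W) :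
    |Real.log (1 / (β₀ * g ^ 2)) - Real.log (1 / (β₀ * h ^ 2))| ≤ W * h ^ 2 := by
  have hh : 0 < h := hg.trans_le hgh
  have hratio : 1 / (β₀ * g ^ 2) / (1 / (β₀ * h ^ 2)) = h ^ 2 / g ^ 2 := by field_simp
  rw [← Real.log_div (by positivity) (by positivity), hratio]
  have hge : 1 ≤ h ^ 2 / g ^ 2 := by
    rw [le_div_iff₀ (by positivity), one_mul]; exact pow_le_pow_left₀ hg.le hgh 2
  have hlo : 0 ≤ Real.log (h ^ 2 / g ^ 2) := Real.log_nonneg hge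
  have hhi : Real.log (h ^ 2 / g ^ 2) ≤ h ^ 2 / g ^ 2 - 1 := Real.log_le_sub_one_of_pos (by positivity)
  have hexp : h ^ 2 / g ^ 2 - 1 = h ^ 2 * (1 / g ^ 2 - 1 / h ^ 2) := by field_simp
  rw [abs_of_nonneg hlo]
  calc Real.log (h ^ 2 / g ^ 2) ≤ h ^ 2 * (1 / g ^ 2 - 1 / h ^ 2) := by rw [← hexp]; exact hhi
    _ ≤ h ^ 2 * W := mul_le_mul_of_nonneg_left hW (by positivity)
    _ = W * h ^ 2 := mul_comm _ _

/-- **ACROSS A BRACKET OF THE REFERENCE TRAJECTORY.**  Under the data of part 44's isometry plus the value β₀ at zero and a box solution h′ from e′, with Λ₂ a dynamical Abel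
function (any comparison sequence): for `h′(m+1) < g ≤ h′(m)` the two-loop scaling expressions at g and at `h′ m` differ by at most
**`κ·h′(m)·W + (|b₁|∕β₀)·W·h′(m)²`**, `κ = 64C_m∕(3(1−θ)β*)`, `W = β₀ + C_mγ∕(1−θ)`: part 44's isometry for the Λ₂- and chart-terms, `abs_log_chart_ratio_le` for the
logarithm. [folklore] -/
theorem abs_twoLoopScaling_sub_le {B : (ℕ → ℝ) → ℝ} {Cm θ γ β₀ b₁ bs ta gs e' : ℝ} {t h' : ℕ → ℝ} {a : ℕ → ℝ} {Λ₂ : ℝ → ℝ}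
    (hB : MemoryProfile Cm θ γ B) (hCm : 0 ≤ Cm) (hθ0 : 0 ≤ θ) (hθ1 : θ < 1) (hbs : 0 < bs) (hta : 0 < ta)
    (h0 : ∀ u : ℕ → ℝ, SeqBox γ u → |B u - β₀| ≤ Cm * ∑' j, θ ^ j * u j)
    (hts : SeqBox γ t) (htf : MemFlow B gs t) (hprof : ∀ m : ℕ, 1 / ta ^ 2 + bs * (m : ℝ) ≤ 1 / (t m) ^ 2)
    (hΛ₂ : ∀ e ∈ Ioc (0 : ℝ) e', ∀ h : ℕ → ℝ, SeqBox γ h → MemFlow B e h → Tendsto (fun n => 1 / h n ^ 2 - a n) atTop (𝓝 (Λ₂ e)))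
    (h2e' : 2 * e' ≤ γ)
    (hs1 : 4 * Cm * e' ≤ bs * (1 - θ))
    (hs2 : e' ^ 2 * (1 / gs ^ 2 + Cm * γ / (1 - θ) ^ 2 + (2 * Cm / ((1 - θ) * bs)) ^ 2) ≤ 3 / 4)
    (hs4 : 64 * Cm * e' ^ 3 ≤ (1 - θ) ^ 2) (hs5 : Cm * (8 * e' ^ 3 + 16 * e' / bs) ≤ (1 - θ) / 4)
    (hhs' : SeqBox γ h') (hhf' : MemFlow B e' h') {g : ℝ} {m : ℕ} (hg : 0 < g) (hm1 : h' (m + 1) < g) (hm2 : g ≤ h' m) :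
    |(Λ₂ g - 1 / g ^ 2 + b₁ / β₀ * Real.log (1 / (β₀ * g ^ 2))) - (Λ₂ (h' m) - 1 / h' m ^ 2 + b₁ / β₀ * Real.log (1 / (β₀ * h' m ^ 2)))|
      ≤ 64 * Cm / (3 * (1 - θ) * bs) * h' m * (β₀ + Cm * γ / (1 - θ)) + |b₁| / β₀ * ((β₀ + Cm * γ / (1 - θ)) * h' m ^ 2) := by
  have h1θ : 0 < 1 - θ := by linarith
  have hβ₀ : 0 < β₀ :=
    EriceFlowEnclosureB12AsPrintedHistoryContagionShiftFlowZero.valueAtZero_pos hCm hθ0 hθ1 hbs hta h0 hts htf hprof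
  have hm0 : 0 < h' m := (hhs' m).1
  have hm0' : 0 < h' (m + 1) := (hhs' (m + 1)).1
  have hme' : h' m ≤ e' := (succ_le_of_reference_flow hB hCm hθ0 hθ1 hbs hta h0 hts htf hprof hhs' hhf' hs1 hs2 m).2.2
  have hiso := abs_dynAbel_sub_sub_chart_le hB hCm hθ0 hθ1 hbs hta hts htf hprof hΛ₂ h2e' hs1 hs2 hs4 hs5 hg hm2 hme'
  have hinc := invSq_succ_sub_le hCm hθ0 hθ1 h0 hhs' hhf' m
  have hΔW : 1 / g ^ 2 - 1 / h' m ^ 2 ≤ β₀ + Cm * γ / (1 - θ) := by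
    have : 1 / g ^ 2 ≤ 1 / h' (m + 1) ^ 2 := one_div_le_one_div_of_le (by positivity) (pow_le_pow_left₀ hm0'.le hm1.le 2)
    linarith
  have hΔ0 : 0 ≤ 1 / g ^ 2 - 1 / h' m ^ 2 := by
    rw [sub_nonneg]; exact one_div_le_one_div_of_le (by positivity) (pow_le_pow_left₀ hg.le hm2 2)
  have hlog := abs_log_chart_ratio_le hβ₀ hg hm2 hΔW
  have hκ : 0 ≤ 64 * Cm / (3 * (1 - θ) * bs) * h' m := by positivity
  have hI : |(Λ₂ g - Λ₂ (h' m)) - (1 / g ^ 2 - 1 / h' m ^ 2)| ≤ 64 * Cm / (3 * (1 - θ) * bs) * h' m * (β₀ + Cm * γ / (1 - θ)) :=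
    hiso.trans (mul_le_mul_of_nonneg_left hΔW hκ)
  have hII : |b₁ / β₀ * (Real.log (1 / (β₀ * g ^ 2)) - Real.log (1 / (β₀ * h' m ^ 2)))| ≤ |b₁| / β₀ * ((β₀ + Cm * γ / (1 - θ)) * h' m ^ 2) := by
    rw [abs_mul, abs_div, abs_of_pos hβ₀]
    exact mul_le_mul_of_nonneg_left hlog (by positivity)
  calc |(Λ₂ g - 1 / g ^ 2 + b₁ / β₀ * Real.log (1 / (β₀ * g ^ 2))) - (Λ₂ (h' m) - 1 / h' m ^ 2 + b₁ / β₀ * Real.log (1 / (β₀ * h' m ^ 2)))|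
      = |((Λ₂ g - Λ₂ (h' m)) - (1 / g ^ 2 - 1 / h' m ^ 2)) + b₁ / β₀ * (Real.log (1 / (β₀ * g ^ 2)) - Real.log (1 / (β₀ * h' m ^ 2)))| := by ring_nf
    _ ≤ |(Λ₂ g - Λ₂ (h' m)) - (1 / g ^ 2 - 1 / h' m ^ 2)| + |b₁ / β₀ * (Real.log (1 / (β₀ * g ^ 2)) - Real.log (1 / (β₀ * h' m ^ 2)))| := abs_add_le _ _
    _ ≤ _ := add_le_add hI hII

/-- **TWO-LOOP ASYMPTOTIC SCALING: `Λ₂(g) = 1∕g² − (b₁∕β₀)·log(1∕(β₀g²)) + o(1)` AS `g → 0⁺`.**  `B` with memory profile `(C_m, θ)` on ]0, γ]^ℕ and the value β₀ at the zero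
history; ONE AF reference t; the reference pin e′ with part 14's package; a box solution h′ from e′; Λ₂ ANY dynamical Abel function with the two-loop comparison sequence
`a(n) = nβ₀ + (b₁∕β₀) log n` (part 40 supplies one under the two-loop letter with memory).  THEN **`Λ₂ g − 1∕g² + (b₁∕β₀)·log(1∕(β₀g²)) → 0` as `g → 0⁺`**: the expansion holds
along the reference trajectory (`tendsto_twoLoopScaling_seq`), the brackets `]h′(m+1), h′(m)]` exhaust a neighbourhood of 0⁺, and across each bracket the expression varies by
at most `κ·h′(m)·W + (|b₁|∕β₀)·W·h′(m)² → 0` (`abs_twoLoopScaling_sub_le`).  The RG-invariant two-loop Λ-parameter is, to o(1), an explicit universal function of the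
coupling — with part 45, Λ₂ is THE Abel function with this property. [folklore] -/
theorem tendsto_twoLoopScaling {B : (ℕ → ℝ) → ℝ} {Cm θ γ β₀ b₁ bs ta gs e' : ℝ} {t h' : ℕ → ℝ} {Λ₂ : ℝ → ℝ}
    (hB : MemoryProfile Cm θ γ B) (hCm : 0 ≤ Cm) (hθ0 : 0 ≤ θ) (hθ1 : θ < 1) (hbs : 0 < bs) (hta : 0 < ta)
    (h0 : ∀ u : ℕ → ℝ, SeqBox γ u → |B u - β₀| ≤ Cm * ∑' j, θ ^ j * u j)
    (hts : SeqBox γ t) (htf : MemFlow B gs t) (hprof : ∀ m : ℕ, 1 / ta ^ 2 + bs * (m : ℝ) ≤ 1 / (t m) ^ 2)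
    (hΛ₂ : ∀ e ∈ Ioc (0 : ℝ) e', ∀ h : ℕ → ℝ, SeqBox γ h → MemFlow B e h →
      Tendsto (fun n => 1 / h n ^ 2 - ((n : ℝ) * β₀ + b₁ / β₀ * Real.log (n : ℝ))) atTop (𝓝 (Λ₂ e)))
    (he' : 0 < e') (h2e' : 2 * e' ≤ γ)
    (hs1 : 4 * Cm * e' ≤ bs * (1 - θ))
    (hs2 : e' ^ 2 * (1 / gs ^ 2 + Cm * γ / (1 - θ) ^ 2 + (2 * Cm / ((1 - θ) * bs)) ^ 2) ≤ 3 / 4)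
    (hs4 : 64 * Cm * e' ^ 3 ≤ (1 - θ) ^ 2) (hs5 : Cm * (8 * e' ^ 3 + 16 * e' / bs) ≤ (1 - θ) / 4)
    (hhs' : SeqBox γ h') (hhf' : MemFlow B e' h') :
    Tendsto (fun g : ℝ => Λ₂ g - 1 / g ^ 2 + b₁ / β₀ * Real.log (1 / (β₀ * g ^ 2))) (𝓝[>] 0) (𝓝 0) := by
  have h1θ : 0 < 1 - θ := by linarith
  set F : ℝ → ℝ := fun g => Λ₂ g - 1 / g ^ 2 + b₁ / β₀ * Real.log (1 / (β₀ * g ^ 2)) with hF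
  set W : ℝ := β₀ + Cm * γ / (1 - θ) with hW
  set κ : ℝ := 64 * Cm / (3 * (1 - θ) * bs) with hκ
  -- the error across the m-th bracket tends to 0 with h′ m
  have hprof' : ∀ m : ℕ, 1 / (2 * e') ^ 2 + bs / 4 * (m : ℝ) ≤ 1 / (h' m) ^ 2 := fun m => by
    have := invSq_lower_of_reference_flow hB hCm hθ0 hθ1 hbs hta hts htf hprof hhs' hhf' hs1 hs2 m
    rwa [show (1 : ℝ) / (2 * e') ^ 2 = 1 / (4 * e' ^ 2) by ring]
  have henv : ∀ m, h' m ≤ 1 / sprof (2 * e') (bs / 4) m := fun m =>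
    le_envelope_of_reference_flow hB hCm hθ0 hθ1 hbs hta hts htf hprof he' le_rfl hhs' hhf' hs1 hs2 m
  have hlim0 : Tendsto h' atTop (𝓝 0) := by
    have hc : Tendsto (fun m => 1 / sprof (2 * e') (bs / 4) m) atTop (𝓝 0) := by
      refine Metric.tendsto_atTop.mpr fun ε hε => ?_
      obtain ⟨n₀, hn₀⟩ := exists_tail_scale_le (by positivity : (0 : ℝ) < 2 * e') (by positivity : (0 : ℝ) < bs / 4) (half_pos hε)
      refine ⟨n₀, fun n hn => ?_⟩
      rw [Real.dist_eq, sub_zero, abs_of_pos (one_div_sprof_pos (by positivity) (by positivity) n)]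
      linarith [hn₀ n hn]
    exact squeeze_zero (fun m => (hhs' m).1.le) henv hc
  have hρ : Tendsto (fun m : ℕ => κ * h' m * W + |b₁| / β₀ * (W * h' m ^ 2)) atTop (𝓝 0) := by
    have h1 : Tendsto (fun m : ℕ => κ * h' m * W) atTop (𝓝 (κ * 0 * W)) := (hlim0.const_mul κ).mul_const W
    have h2 : Tendsto (fun m : ℕ => |b₁| / β₀ * (W * h' m ^ 2)) atTop (𝓝 (|b₁| / β₀ * (W * 0 ^ 2))) := ((hlim0.pow 2).const_mul W).const_mul _
    simpa using h1.add h2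
  have hseq := tendsto_twoLoopScaling_seq hB hCm hθ0 hθ1 hbs hta h0 hts htf hprof hΛ₂ he' hs1 hs2 hhs' hhf'
  have hanti : StrictAnti h' := strictAnti_nat_of_succ_lt fun m =>
    (succ_le_of_reference_flow hB hCm hθ0 hθ1 hbs hta h0 hts htf hprof hhs' hhf' hs1 hs2 m).2.1
  -- ε-δ
  refine Metric.tendsto_nhdsWithin_nhds.mpr fun ε hε => ?_
  obtain ⟨M₁, hM₁⟩ := Metric.tendsto_atTop.mp hseq (ε / 2) (half_pos hε)
  obtain ⟨M₂, hM₂⟩ := Metric.tendsto_atTop.mp hρ (ε / 2) (half_pos hε)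
  set M : ℕ := max M₁ M₂ with hM
  refine ⟨h' M, (hhs' M).1, fun g hg hdist => ?_⟩
  have hg0 : 0 < g := hg
  rw [Real.dist_eq, sub_zero, abs_of_pos hg0] at hdist
  have hMe' : h' M ≤ e' := (succ_le_of_reference_flow hB hCm hθ0 hθ1 hbs hta h0 hts htf hprof hhs' hhf' hs1 hs2 M).2.2
  obtain ⟨m, hm1, hm2⟩ := exists_bracket hhf'.1 hlim0 hg0 (hdist.le.trans hMe')
  -- the bracket index is beyond M
  have hmM : M ≤ m := by
    by_contra hlt
    have hlt' : m + 1 ≤ M := by omega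
    have : h' M ≤ h' (m + 1) := hanti.antitone hlt'
    linarith
  have hb := abs_twoLoopScaling_sub_le (b₁ := b₁) hB hCm hθ0 hθ1 hbs hta h0 hts htf hprof hΛ₂ h2e' hs1 hs2 hs4 hs5 hhs' hhf' hg0 hm1 hm2
  have e1 := hM₁ m ((le_max_left _ _).trans hmM)
  have e2 := hM₂ m ((le_max_right _ _).trans hmM)
  rw [Real.dist_eq, sub_zero] at e1 e2
  have hρm : κ * h' m * W + |b₁| / β₀ * (W * h' m ^ 2) < ε / 2 := lt_of_abs_lt e2
  rw [Real.dist_eq, sub_zero]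
  calc |F g| = |(F g - F (h' m)) + F (h' m)| := by ring_nf
    _ ≤ |F g - F (h' m)| + |F (h' m)| := abs_add_le _ _
    _ < ε / 2 + ε / 2 := add_lt_add_of_le_of_lt (hb.trans hρm.le) e1
    _ = ε := by ring

end

end Summit.QuantumFields.BalabanUV.Beta.EriceFlowEnclosureB12AsPrintedHistoryContagionShiftFlowZeroIsometryTwoLoop
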